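import Literature.NumberTheory.EllipticCurves.IwasawaAlgebraCharIdealProofs
import Literature.NumberTheory.EllipticCurves.IwasawaAlgebraRankOneIdealProofs
import Literature.NumberTheory.EllipticCurves.IwasawaAlgebraPseudoNullProofs
import HarnessLib

/-!
# Crux 4 `BSDpOnCellC` (stmt-BirchSwinnertonDyer-19034), line «telescope», sub-leaf W4 (PURITY) of leaf N2 —
# the algebraic half of «route G»: purity of the `π`-torsion from «no non-zero pseudo-null submodule» + a regular
# annihilator (pure commutative algebra; LEAD cruxlead-19034 g2; `--supports`, helper; closes nothing)

Context. In the registered telescope skeleton (v8) the weight-two leaf N2 `stub_weightTwoControl` carries one research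
sub-input, ideator bsd-idea-12 g36's W4 `K2Weight2.stub_weightTwoPurity` (`Lines/telescopeK2weight2.lean`): for the big
dual Selmer module `X₂` over `B = ℤ_p⟦X⟧⟦T⟧`, `(p^m) ⊆ char_Λ(X₂[C X])` for some `m` (`Λ = ℤ_p⟦T⟧`). The LEAD's finding
(bus 2026-08-29 ≈21:03Z, «route G»): under (reg₀) — a killing element `s` with `C X ∤ s` — the `C X`-torsion `X₂[C X]` is a
PSEUDO-NULL `B`-submodule (it is killed by the prime `C X` and by `s ∉ (C X)`, an ideal lying in no prime of height `≤ 1`),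
so it VANISHES as soon as `X₂` has no non-zero pseudo-null `B`-submodule — Greenberg's «almost divisibility» of the big
Selmer group, available RESIDUAL-IMAGE-FREE through Greenberg 2016 Prop. 4.1.1 alternative (c) (tree theorem
`Greenberg2016.selmer_noPseudoNull_caseC_of_facts'` with `fullAtSpecification_Q_isCoreflexive` for the full condition at
`𝔭`). This file is the ALGEBRA of that reduction, for any Noetherian domain `B`, prime `π`, and auxiliary coefficient
ring `Λ` acting compatibly:

* `isPseudoNull_torsionBy_of_prime_of_not_dvd` — `M[π]` is pseudo-null over `B` when `π` is prime and some `s` with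
  `π ∤ s` kills `M` (no finiteness needed): at a prime `𝔭` of height `≤ 1`, either `π ∉ 𝔭` (and `π` kills `M[π]`) or
  `𝔭 = (π)` (a prime strictly above the height-one prime `(π)` has height `≥ 2`), whence `s ∉ 𝔭`.
* `torsionBy_eq_bot_of_noPseudoNull` — hence `M[π] = ⊥` if every pseudo-null `B`-submodule of `M` is `⊥`
  (Greenberg's «`X` has no non-zero pseudo-null submodule», the shape of `Greenberg2016.HasNoPseudoNullSubmodule`).
* `span_le_charIdeal_torsionBy_of_noPseudoNull` — and then `(c) ⊆ char_Λ(M[π])` for EVERY `c ∈ Λ` (the characteristic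
  ideal of the zero module is `⊤`), in particular W4's `∃ m, (C (p^m)) ⊆ char_{ℤ_p⟦T⟧}(X₂[C X])` with `m = 0`
  (`exists_span_C_pow_le_charIdeal_torsionBy_CX`, stated for an arbitrary `B = ℤ_p⟦X⟧⟦T⟧`-module with a compatible
  `ℤ_p⟦T⟧`-structure, which is how `XBig κ ρ₂ 𝔭̄ ∅` enters W4).

So W4 ⟸ «`X₂` has no non-zero pseudo-null `B`-submodule» ∧ (reg₀); what remains of route G is Galois-cohomological
(LEO / CRK / LOC⁽¹⁾_𝔭 / LOC⁽²⁾ for the Hida big module and the dictionary `selmerBig ↔ S_𝓛`), cf. the x1 lane's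
`EisensteinPrimesNoPseudoNullOfBridgeOfTate.lean` for the one-variable twist deformation.

HONEST FRAMING: commutative algebra over binders; nothing about any curve, newform or `L`-function is asserted; no
summit statement, no stub, no crux is proved; BSD is proved for no curve; 0 cells / labels / tiers move. THEOREMS ONLY
(no definition, no named fact, no `sorry`, no instance, no notation).

## References
[cite: BourbakiAC5to7, Ch. VII §4 no. 4 Def. 2, no. 5] [cite: Greenberg2016Selmer, §1 p. 2 (almost divisible ⟺ no non-zero pseudo-null submodule), Prop. 4.1.1 (c)]
[cite: Ochiai2006, Prop. 8.1 (shape only)]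
-/

set_option autoImplicit false
-- D-0017: single-problem summit, the namespace repeats the problem name by design.
set_option linter.dupNamespace false

noncomputable section

namespace Summit.BirchSwinnertonDyer.BirchSwinnertonDyer.Theorems.TelescopeK2PurityOfNoPseudoNull

open Literature.NumberTheory.EllipticCurves

variable {B : Type*} [CommRing B] {M : Type*} [AddCommGroup M] [Module B M]

/-! ## §1 The `π`-torsion of a module with a regular annihilator is pseudo-null -/

/-- **`M[π]` is pseudo-null** over a Noetherian domain `B` when `π` is a prime element and some `s` with `π ∤ s`
kills `M`: for a prime `𝔭` of height `≤ 1`, if `π ∉ 𝔭` then `π` (which kills `M[π]`) is a unit at `𝔭`; if `π ∈ 𝔭`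
then `𝔭 = (π)` — `(π)` is a height-one prime and a prime strictly above it has height `≥ 2` — so `s ∉ 𝔭` and `s`
kills `M[π]`. [cite: BourbakiAC5to7, Ch. VII §4 no. 4 Def. 2] -/
theorem isPseudoNull_torsionBy_of_prime_of_not_dvd [IsNoetherianRing B] [IsDomain B] {π s : B} (hπ : Prime π)
    (hs : ¬ π ∣ s) (hsM : ∀ m : M, s • m = 0) :
    Module.IsPseudoNull B ↥(Submodule.torsionBy B M π) := by
  haveI hprime : (Ideal.span {π}).IsPrime := (Ideal.span_singleton_prime hπ.ne_zero).mpr hπ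
  intro 𝔭 h𝔭
  rw [LocalizedModule.subsingleton_iff]
  intro m
  by_cases hπ𝔭 : π ∈ 𝔭.asIdeal
  · -- `𝔭 = (π)`, hence `s ∉ 𝔭`
    have hle : Ideal.span {π} ≤ 𝔭.asIdeal := (Ideal.span_singleton_le_iff_mem _).mpr hπ𝔭
    have heq : Ideal.span {π} = 𝔭.asIdeal := by
      by_contra hne
      have hlt : Ideal.span {π} < 𝔭.asIdeal := lt_of_le_of_ne hle hne
      haveI : (Ideal.span {π}).FiniteHeight := by
        rw [Ideal.finiteHeight_iff, Module.height_span_singleton_eq_one_of_prime hπ]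
        exact Or.inr ENat.one_ne_top
      have h := Ideal.height_strict_mono_of_isPrime hlt
      rw [Module.height_span_singleton_eq_one_of_prime hπ] at h
      exact absurd h𝔭 (not_le.mpr h)
    refine ⟨s, ?_, ?_⟩
    · intro hs𝔭
      rw [← heq] at hs𝔭
      exact hs (Ideal.mem_span_singleton.mp hs𝔭)
    · exact Subtype.ext (by simpa using hsM (m : M))
  · refine ⟨π, hπ𝔭, ?_⟩
    exact Subtype.ext (by simp)

/-! ## §2 … hence zero when the module has no non-zero pseudo-null submodule -/

/-- **`M[π] = 0`** when every pseudo-null `B`-submodule of `M` is `⊥` (Greenberg's «no non-zero pseudo-null submodule»,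
the shape of `Greenberg2016.HasNoPseudoNullSubmodule`), `π` is prime and some `s` with `π ∤ s` kills `M`.
[cite: Greenberg2016Selmer, §1 p. 2] -/
theorem torsionBy_eq_bot_of_noPseudoNull [IsNoetherianRing B] [IsDomain B]
    (hN : ∀ P : Submodule B M, Module.IsPseudoNull B ↥P → P = ⊥) {π s : B} (hπ : Prime π)
    (hs : ¬ π ∣ s) (hsM : ∀ m : M, s • m = 0) :
    Submodule.torsionBy B M π = ⊥ :=
  hN _ (isPseudoNull_torsionBy_of_prime_of_not_dvd hπ hs hsM)

/-! ## §3 … hence every `c ∈ Λ` lies in the `Λ`-characteristic ideal of `M[π]` -/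

/-- **Purity from «no pseudo-null»**: for a coefficient ring `Λ` acting on `M` compatibly with `B`, EVERY `c ∈ Λ`
satisfies `(c) ⊆ char_Λ(M[π])` — because `M[π] = 0` (`torsionBy_eq_bot_of_noPseudoNull`) and the characteristic
ideal of the zero module is `⊤`. [cite: BourbakiAC5to7, Ch. VII §4 no. 5] -/
theorem span_le_charIdeal_torsionBy_of_noPseudoNull [IsNoetherianRing B] [IsDomain B]
    {Λ : Type*} [CommRing Λ] [Module Λ M] [SMul Λ B] [IsScalarTower Λ B M]
    (hN : ∀ P : Submodule B M, Module.IsPseudoNull B ↥P → P = ⊥) {π s : B} (hπ : Prime π)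
    (hs : ¬ π ∣ s) (hsM : ∀ m : M, s • m = 0) (c : Λ) :
    Ideal.span {c} ≤ Module.charIdeal Λ ↥(Submodule.torsionBy B M π) := by
  have hbot := torsionBy_eq_bot_of_noPseudoNull hN hπ hs hsM
  haveI : Subsingleton ↥(Submodule.torsionBy B M π) := by
    refine ⟨fun a b => Subtype.ext ?_⟩
    have ha : (a : M) = 0 := (Submodule.mem_bot B).mp (hbot ▸ a.2)
    have hb : (b : M) = 0 := (Submodule.mem_bot B).mp (hbot ▸ b.2)
    rw [ha, hb]
  rw [Module.charIdeal_eq_top_of_isPseudoNull (Module.isPseudoNull_of_subsingleton Λ _)]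
  exact le_top

/-! ## §4 The two-variable instance: `B = ℤ_p⟦X⟧⟦T⟧`, `π = C X`, `Λ = ℤ_p⟦T⟧`, `c = C (p^m)` (W4's shape) -/

/-- `C X` is a prime element of `R⟦X⟧⟦T⟧ = PowerSeries (PowerSeries R)` for a domain `R` (the inner variable as a
constant of the outer power-series ring; `prime_C_of_prime` applied to `PowerSeries.X_prime`). [folklore] -/
theorem prime_C_X {R : Type*} [CommRing R] [IsDomain R] :
    Prime (PowerSeries.C (PowerSeries.X : PowerSeries R) : PowerSeries (PowerSeries R)) :=
  prime_C_of_prime PowerSeries.X_prime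

/-- **W4's conclusion from «no pseudo-null» + (reg₀)**, for an arbitrary `ℤ_p⟦X⟧⟦T⟧`-module `N` with a compatible
`ℤ_p⟦T⟧`-structure (this is how `XBig κ ρ₂ 𝔭̄ ∅` enters `K2Weight2.stub_weightTwoPurity`): if every pseudo-null
`ℤ_p⟦X⟧⟦T⟧`-submodule of `N` is `⊥` and some `s` with `C X ∤ s` kills `N`, then `(C (p^m)) ⊆ char_{ℤ_p⟦T⟧}(N[C X])`
for some `m` (indeed `m = 0`). [cite: Greenberg2016Selmer, Prop. 4.1.1 (c) (shape only)] -/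
theorem exists_span_C_pow_le_charIdeal_torsionBy_CX {p : ℕ} [Fact p.Prime]
    {N : Type*} [AddCommGroup N] [Module (PowerSeries (PowerSeries ℤ_[p])) N]
    [Module (PowerSeries ℤ_[p]) N]
    [IsScalarTower (PowerSeries ℤ_[p]) (PowerSeries (PowerSeries ℤ_[p])) N]
    (hN : ∀ P : Submodule (PowerSeries (PowerSeries ℤ_[p])) N,
      Module.IsPseudoNull (PowerSeries (PowerSeries ℤ_[p])) ↥P → P = ⊥)
    (hreg : ∃ s : PowerSeries (PowerSeries ℤ_[p]),
      ¬ (PowerSeries.C (PowerSeries.X : PowerSeries ℤ_[p]) ∣ s) ∧ ∀ m : N, s • m = 0) :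
    ∃ m : ℕ, Ideal.span {PowerSeries.C ((p : ℤ_[p]) ^ m)} ≤
      Module.charIdeal (PowerSeries ℤ_[p])
        ↥(Submodule.torsionBy (PowerSeries (PowerSeries ℤ_[p])) N
          (PowerSeries.C (PowerSeries.X : PowerSeries ℤ_[p]))) := by
  obtain ⟨s, hs, hsN⟩ := hreg
  exact ⟨0, span_le_charIdeal_torsionBy_of_noPseudoNull hN prime_C_X hs hsN _⟩

end Summit.BirchSwinnertonDyer.BirchSwinnertonDyer.Theorems.TelescopeK2PurityOfNoPseudoNull

end
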